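import Summits.QuantumFields.BalabanUV.T4Continuum.Support.NE3SlicePoincareCoreBound
import Summits.QuantumFields.BalabanUV.T4Continuum.Support.NE3SlicePoincareRemainderRho
import Summits.QuantumFields.BalabanUV.T4Continuum.Support.NE3SlicePoincareRemainderComb
import Summits.QuantumFields.BalabanUV.T4Continuum.Support.NE3SlicePoincareRemainderE
import Summits.QuantumFields.BalabanUV.T4Continuum.Support.NE3TowerBondVsSegment
import HarnessLib

/-!
# NE3SlicePoincareEtaBound (T⁴ programme, node NE3, row K6 of the owner's ruling ρ-g22-2, part K6c-1a of the cut ρ-g23-3 §3) — THE η′-BOUND OF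
# ROUTE H♮ IN PRODUCT FORM: (S3∕S4a)∘(S4b) AT `U := cavgIter`, `ψ := bmeanIterW ζ′`, WITH THE THREE REMAINDER PAIRINGS BOUNDED BY NAME

NE3 (node U1b) formalisation swarm `b2b-balaban-t4-ne3-formalise-*`, leaf seat `b2b-balaban-t4-ne3-formalise-leaf-02` (gen 6), row **K6**
(assembly of the curved (P♮), booked → leaf-02 lineage; blueprint `HOME/t4/b2b-balaban-t4-ne3-p1/g23/D-ne3p1-g23-1.md` = ruling ρ-g23-3 §1–§2,
disprover D-ne3r2-g9-1: instantiation names `cavgIter_unitary_small` ∕ `isPeriodicCfg_cavgIter` ∕ `bmeanIterW_skew_periodic`).  Composition, BY NAME, of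
K6b-0 `NE3SlicePoincareCoreBound.sum_nhsNormSq_le_core_sbound`, K6b-1 `NE3SlicePoincareRemainderRho.abs_sum_hsR_rho_psiExt_le`, K6b-2a
`NE3SlicePoincareRemainderComb.abs_sum_hsR_combDefect_le`, leaf-03-g8's K6-face `NE3CovariantFacePairings.abs_sum_hsR_{far,near}Defect_le` ∕
`abs_sum_hsR_coarseMismatch_le` (β := NE3-R2's J4 `NE3TowerBondVsSegment.norm_cavgIter_sub_bseg_le_top`), K6b-3 `NE3SlicePoincareRemainderE.abs_RE_le` ∕
`weightedEnergy_nonexact_le`.  All [folklore], 0 sorry, 0 def: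
§1 splitting of the signed loop remainder into its four absolute pairings (`abs_sum_hsR_loops_le`); the cast identities `inv_pow_tower`,
   `pow_tower_d` (`((L^d)⁻¹)^{k+1} = ((L^{k+1})^d)⁻¹`, so that K6b-0's `M^{−d}•TWg M (combFrame W M)` IS K6b-3's `((L^d)⁻¹)^{k+1}•TWc L (k+1) W`, rfl);
   the scalar bookkeeping `core_assemble` (`16m⁻¹(R_E − mR_ρ + mR_l) ≤ 16(m⁻¹|R_E|) + 16|R_ρ| + 16|R_l|`);
§2 **`eta_sq_le`** — for `Y ∈ frameFreeBlockLandauW L N (k+1) W` in the tower class (`2 ≤ L`, `1 ≤ N`, `1 ≤ d`, unitary `W`, `IsPeriodicCfg W (tower L N (k+1))`,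
   `0 ≤ x`, `LevelSmall d L k x`, `SmallField W x`, `S2sum d L (k+1) x ≤ rho d L ∕ 2`) and ANY decomposition `Y = η′ + gaugeDir W ζ′` with `η′` periodic,
   `ζ′` periodic and 𝔲(n)-valued and `Σ hsR ζ′ (covDiv W η′) = 0` (K1-inst (S2)(iii)), with `M = L^{k+1}`, `U = cavgIter L (k+1) W`, `ψ = bmeanIterW L (k+1) W ζ′`,
   sums over `periodBox (L^{k+1}·N)` (fine) ∕ `periodBox N` (coarse):
   `h² ≤ 18M²·CG + (80d+448)d²(M²x)²·h² + 16·√ℰ′·√Φ + 16·√(Σ‖covDiv W η′‖²)·√(2M²·Σ‖D_Wζ′‖² + K·Σ‖ζ′‖²) + 16·B_comb(ψ) + 16·(B_mis + B_far + B_near)(ψ)`,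
   `Φ := 2M⁻²h² + 2·Σ nhsNormSq (covFd W η′ · κ κ)`, `ℰ′` = K6b-3's bound, `K` = K6b-1's constant, `B_…` = the right-hand sides of the named pairing lemmas at this `ψ`
   (β := J4 = `8·loopRad d L ((prop1Radius d L)^[k] x)`) — every factor a named tree quantity, no Young inequality applied yet:
   K6c-2 inserts K1-inst's (i)(ii), K6b-S5 for `CG`, NE3-R2's Jensen (L1) for `Σ‖ψ‖²`, the S7 competitor and K6-Ξ, and absorbs with `2ab ≤ δa² + δ⁻¹b²`.
HONEST FRAMING.  Bookkeeping on OUR lattice objects at ONE unitary background in the tower's small-field class; nothing about Bałaban's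
minimisers; (P♮)_W, (ML_w) at `W ≠ 1`, T-E_w and NE3 are NOT proved; spine PROVED 0∕9; finite T⁴ rung (B)+1 — NOT infinite volume, NOT mass gap,
NOT BetaPertH, NOT Clay.  ABSOLUTE RULE kept: no printed sentence is a hypothesis (context only: [Balaban1985Averaging] (120)–(125);
[Balaban1985PropagatorsII] Thm 3.3 (3.46)).  PLACEMENT: `Summits/QuantumFields/BalabanUV/`; imports accepted modules only; moves nothing.
HONEST DEPENDENCY: continuum YM on T⁴ ⇐ BetaPertH ∧ nine spine estimates (0/9 proved); BetaPertH ⇐ (D1) ∧ (D4) ∧ CAP+tail; G-an2-4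
gates asym, D1 and NE2/3/4.
-/

set_option autoImplicit false

open scoped BigOperators Matrix.Norms.L2Operator
open Finset

namespace Summit.QuantumFields.BalabanUV.T4Continuum.NE3SlicePoincareEtaBound

open Literature.MathematicalPhysics.QuantumFieldTheory.Balaban1983to89
open B7Prop1Explicit B7Prop2Explicit MatrixNorms
open T4AveragingDeficitWall (IsUnitaryCfg IsSkewDir SmallField Ad)
open T4AveragingDeficitWallBoundary (IsPeriodicCfg periodBox)
open AveragingDeficitPeriodicCounting (IsPeriodicDir)
open AveragingDeficitCovGrad (covFd)
open AveragingDeficitTwoLevelPrep (prop1Radius)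
open AveragingDeficitMultiLevelPrep (cavgIter tower LevelSmall cavgIter_unitary_small isPeriodicCfg_cavgIter)
open AveragingDeficitBlockDensity (bseg)
open SpreadLift (loopRad)
open BlockAveragePushDirGauge (gaugeDir)
open NE3CovariantCalculus (hsR cD hsR_add_right hsR_sub_right hsR_sum_right)
open NE3CovariantWeitzenbock (covDiv)
open NE3CovariantBlockMean (bmeanIterW bmeanIterW_skew_periodic)
open NE3CovariantLineSumsL2Tower (rho S2sum)
open NE3ExactLineSumsTower (DSum)
open NE3CovariantLineAdjoint (JmpW TWc TWg combFrame)
open NE3CovariantBlockDivergence (combDefect farDefect nearDefect)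
open NE3CovariantLandauKill (coarseMismatch psiExt)
open NE3FrameFreeSliceW (frameFreeBlockLandauW)
open NE3SlicePoincareCoreBound (sum_nhsNormSq_le_core_sbound)
open NE3SlicePoincareRemainderRho (abs_sum_hsR_rho_psiExt_le)
open NE3SlicePoincareRemainderComb (abs_sum_hsR_combDefect_le)
open NE3SlicePoincareRemainderE (abs_RE_le weightedEnergy_nonexact_le)
open NE3CovariantFacePairings (abs_sum_hsR_farDefect_le abs_sum_hsR_nearDefect_le abs_sum_hsR_coarseMismatch_le)
open NE3TowerBondVsSegment (norm_cavgIter_sub_bseg_le_top)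

noncomputable section

variable {d : ℕ} {n : Type*} [Fintype n] [DecidableEq n]

/-! ## §1 Splitting the signed loop remainder -/

/-- The loop pairing splits into its four pieces: `hsR ψ (comb + mis − Σ_κ(far + near)) = hsR ψ comb + hsR ψ mis − hsR ψ (Σ far) − hsR ψ (Σ near)`,
summed over the coarse box, and bounded by the sum of absolute values. [folklore] -/
theorem abs_sum_hsR_loops_le (F : Finset (Site d)) (ψ : Site d → Matrix n n ℂ) (A B : Site d → Matrix n n ℂ)
    (C D : Site d → Fin d → Matrix n n ℂ) :
    |∑ z ∈ F, hsR (ψ z) (A z + B z - ∑ κ : Fin d, (C z κ + D z κ))|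
      ≤ |∑ z ∈ F, hsR (ψ z) (A z)| + |∑ z ∈ F, hsR (ψ z) (B z)|
        + |∑ z ∈ F, hsR (ψ z) (∑ κ : Fin d, C z κ)| + |∑ z ∈ F, hsR (ψ z) (∑ κ : Fin d, D z κ)| := by
  have hsplit : ∑ z ∈ F, hsR (ψ z) (A z + B z - ∑ κ : Fin d, (C z κ + D z κ))
      = ∑ z ∈ F, hsR (ψ z) (A z) + ∑ z ∈ F, hsR (ψ z) (B z)
        - ∑ z ∈ F, hsR (ψ z) (∑ κ : Fin d, C z κ) - ∑ z ∈ F, hsR (ψ z) (∑ κ : Fin d, D z κ) := by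
    rw [← Finset.sum_add_distrib, ← Finset.sum_sub_distrib, ← Finset.sum_sub_distrib]
    refine Finset.sum_congr rfl fun z _ => ?_
    rw [hsR_sub_right, hsR_add_right, Finset.sum_add_distrib, hsR_add_right]
    ring
  rw [hsplit, abs_le]
  constructor <;> linarith [le_abs_self (∑ z ∈ F, hsR (ψ z) (A z)), neg_abs_le (∑ z ∈ F, hsR (ψ z) (A z)),
    le_abs_self (∑ z ∈ F, hsR (ψ z) (B z)), neg_abs_le (∑ z ∈ F, hsR (ψ z) (B z)),
    le_abs_self (∑ z ∈ F, hsR (ψ z) (∑ κ : Fin d, C z κ)), neg_abs_le (∑ z ∈ F, hsR (ψ z) (∑ κ : Fin d, C z κ)),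
    le_abs_self (∑ z ∈ F, hsR (ψ z) (∑ κ : Fin d, D z κ)), neg_abs_le (∑ z ∈ F, hsR (ψ z) (∑ κ : Fin d, D z κ))]

/-! ## §2 The η′-bound in product form -/

/-- `((L^d)⁻¹)^{k+1} = ((L^{k+1})^d)⁻¹` as reals (the block weight). [folklore] -/
theorem inv_pow_tower (L d k : ℕ) : (((L : ℝ) ^ d)⁻¹) ^ (k + 1) = ((((L ^ (k + 1) : ℕ) : ℝ)) ^ d)⁻¹ := by
  push_cast
  rw [inv_pow, ← pow_mul, ← pow_mul, Nat.mul_comm d (k + 1)]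

/-- `(L^{k+1})^d` cast. [folklore] -/
theorem pow_tower_d (L d k : ℕ) : ((L : ℝ) ^ (k + 1)) ^ d = (((L ^ (k + 1) : ℕ) : ℝ)) ^ d := by
  rw [Nat.cast_pow]

/-- BOOKKEEPING for the core bound: `16·m⁻¹·(R_E − m·R_ρ + m·R_l) ≤ 16·(m⁻¹|R_E|) + 16|R_ρ| + 16|R_l|`, each absolute value then
replaced by its bound. [folklore] -/
theorem core_assemble {h2 CG m c RE Rρ Rl BE Bρ Bc Bf : ℝ} (hm : 0 < m)
    (hcore : h2 ≤ 18 * m * CG + 16 * m⁻¹ * (RE - m * Rρ + m * Rl) + c * h2)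
    (hE : m⁻¹ * |RE| ≤ BE) (hρ : |Rρ| ≤ Bρ) (hl : |Rl| ≤ Bc + Bf) :
    h2 ≤ 18 * m * CG + c * h2 + 16 * BE + 16 * Bρ + 16 * Bc + 16 * Bf := by
  have hm' : m ≠ 0 := hm.ne'
  have e : 16 * m⁻¹ * (RE - m * Rρ + m * Rl) = 16 * (m⁻¹ * RE) - 16 * (m⁻¹ * m) * Rρ + 16 * (m⁻¹ * m) * Rl := by ring
  rw [inv_mul_cancel₀ hm'] at e
  have h1 : m⁻¹ * RE ≤ m⁻¹ * |RE| := mul_le_mul_of_nonneg_left (le_abs_self _) (inv_nonneg.2 hm.le)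
  linarith [neg_abs_le Rρ, le_abs_self Rl]

/-- **THE η′-BOUND OF ROUTE H♮ (product form).**  For `Y ∈ frameFreeBlockLandauW L N (k+1) W` in the tower class and ANY decomposition
`Y = η′ + gaugeDir W ζ′` (η′ periodic; ζ′ periodic, 𝔲(n)-valued; `Σ hsR ζ′ (covDiv W η′) = 0`), with `M = L^{k+1}`, `U = cavgIter L (k+1) W`,
`ψ = bmeanIterW L (k+1) W ζ′`, sums over `periodBox (L^{k+1}·N)` (fine) ∕ `periodBox N` (coarse):
`h² ≤ 18M²·CG + (80d+448)d²(M²x)²·h² + 16·√ℰ′·√Φ + 16·√ρ²·√(2M²Σ‖D_Wζ′‖² + KΣ‖ζ′‖²) + 16·B_comb + 16·(B_mis + B_far + B_near)` — every `B` the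
right-hand side of the named pairing lemma at this `ψ`. [folklore] -/
theorem eta_sq_le [Nonempty n] (hd : 1 ≤ d) {L N : ℕ} (hL : 2 ≤ L) (hN : 1 ≤ N) (k : ℕ) {W : Site d → Fin d → (Matrix n n ℂ)ˣ} {x : ℝ}
    (hWu : IsUnitaryCfg W) (hWP : IsPeriodicCfg W ((tower L N (k + 1) : ℕ) : ℤ)) (hx : 0 ≤ x) (hs : LevelSmall d L k x)
    (hWx : SmallField W x) (hS2 : S2sum d L (k + 1) x ≤ rho d L / 2)
    {Y : Site d → Fin d → Matrix n n ℂ} (hY : Y ∈ frameFreeBlockLandauW (d := d) (n := n) L N (k + 1) W)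
    {η' : Site d → Fin d → Matrix n n ℂ} (hη'P : IsPeriodicDir η' ((tower L N (k + 1) : ℕ) : ℤ)) {ζ' : Site d → Matrix n n ℂ}
    (hζ'P : ∀ (y : Site d) (τ : Fin d), ζ' (y + ((tower L N (k + 1) : ℕ) : ℤ) • e τ) = ζ' y)
    (hζ's : ∀ y : Site d, ζ' y ∈ skewAdjoint (Matrix n n ℂ))
    (hYeq : ∀ (y : Site d) (κ : Fin d), Y y κ = η' y κ + gaugeDir W ζ' y κ)
    (horth : ∑ y ∈ periodBox (d := d) (tower L N (k + 1)), hsR (ζ' y) (covDiv W η' y) = 0) :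
    ∑ y ∈ periodBox (d := d) (L ^ (k + 1) * N), ∑ κ : Fin d, nhsNormSq (η' y κ)
      ≤ 18 * (((L ^ (k + 1) : ℕ) : ℝ)) ^ 2 * ∑ y ∈ periodBox (d := d) (L ^ (k + 1) * N), ∑ μ : Fin d, ∑ ν : Fin d, nhsNormSq (covFd W η' y μ ν)
        + (80 * d + 448) * (d : ℝ) ^ 2 * ((((L ^ (k + 1) : ℕ) : ℝ)) ^ 2 * x) ^ 2
            * ∑ y ∈ periodBox (d := d) (L ^ (k + 1) * N), ∑ κ : Fin d, nhsNormSq (η' y κ)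
        -- `16·M⁻²·|R_E| ≤ 16·√ℰ′·√Φ`
        + 16 * (Real.sqrt (4 * (2 * ((4 * d + 5) / 10 * DSum d L (k + 1) x)) ^ 2 * ((L : ℝ) ^ (k + 1)) ^ 2
                    * ((Fintype.card n : ℝ) * ∑ y ∈ periodBox (d := d) (L ^ (k + 1) * N), ∑ κ : Fin d, nhsNormSq (η' y κ))
                  + 16 * S2sum d L (k + 1) x ^ 2 * ((L : ℝ) ^ d * ((L : ℝ) ^ k) ^ 2)
                    * ((Fintype.card n : ℝ) * ∑ y ∈ periodBox (d := d) (L ^ (k + 1) * N), ∑ κ : Fin d, nhsNormSq (Y y κ))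
                  + 2 * ((d : ℝ) * (20 * loopRad d L ((prop1Radius d L)^[k] x)) ^ 2)
                    * ((Fintype.card n : ℝ) * ∑ y ∈ periodBox (d := d) (L ^ (k + 1) * N), nhsNormSq (ζ' y)))
              * Real.sqrt (2 * ((((L ^ (k + 1) : ℕ) : ℝ)) ^ 2)⁻¹ * ∑ y ∈ periodBox (d := d) (L ^ (k + 1) * N), ∑ κ : Fin d, nhsNormSq (η' y κ)
                  + 2 * ∑ y ∈ periodBox (d := d) (L ^ (k + 1) * N), ∑ κ : Fin d, nhsNormSq (covFd W η' y κ κ)))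
        -- `16·|R_ρ∕M²|`
        + 16 * (Real.sqrt (∑ y ∈ periodBox (d := d) (L ^ (k + 1) * N), nhsNormSq (covDiv W η' y))
              * Real.sqrt (2 * ((L : ℝ) ^ (k + 1)) ^ 2 * ∑ y ∈ periodBox (d := d) (L ^ (k + 1) * N), ∑ μ : Fin d, nhsNormSq (gaugeDir W ζ' y μ)
                  + (8 * d * (((L : ℝ) ^ (k + 1)) * (((d : ℝ) - 1) * (((L : ℝ) ^ (k + 1)) - 1) * x)) ^ 2
                      + 2 * (Fintype.card n * (4 * (d : ℝ) ^ 2 * ((L : ℝ) ^ (k + 1) - 1) ^ 2 * x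
                          + 16 * d * loopRad d L ((prop1Radius d L)^[k] x)) ^ 2))
                    * ∑ y ∈ periodBox (d := d) (L ^ (k + 1) * N), nhsNormSq (ζ' y)))
        -- the comb pairing
        + 16 * (2 * (((d : ℝ) - 1) * ((((L ^ (k + 1) : ℕ) : ℝ)) - 1) * x) * Real.sqrt ((Fintype.card n : ℝ) * d)
              * Real.sqrt (∑ z ∈ periodBox (d := d) N, (((L ^ (k + 1) : ℕ) : ℝ)) ^ d * nhsNormSq (bmeanIterW L (k + 1) W ζ' z))
              * Real.sqrt (∑ y ∈ periodBox (d := d) (L ^ (k + 1) * N), ∑ μ : Fin d, nhsNormSq (η' y μ)))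
        -- the coarse mismatch (β = J4) and the two faces
        + 16 * ((2 * (8 * loopRad d L ((prop1Radius d L)^[k] x)) + 2 * (2 * (((d : ℝ) - 1) * ((((L ^ (k + 1) : ℕ) : ℝ)) - 1) * (((L ^ (k + 1) : ℕ) : ℝ)) * x)))
              * Real.sqrt (Fintype.card n)
              * (Real.sqrt ((d : ℝ) * ∑ z ∈ periodBox (d := d) N, nhsNormSq (bmeanIterW L (k + 1) W ζ' z))
                * Real.sqrt ((((L ^ (k + 1) : ℕ) : ℝ)) ^ (d - 1) * (2 / (((L ^ (k + 1) : ℕ) : ℝ)) * ∑ y ∈ periodBox (d := d) (L ^ (k + 1) * N), ∑ κ : Fin d, nhsNormSq (η' y κ)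
                    + 2 * (((L ^ (k + 1) : ℕ) : ℝ)) * ∑ y ∈ periodBox (d := d) (L ^ (k + 1) * N), ∑ κ : Fin d, nhsNormSq (covFd W η' y κ κ))))) := by
  haveI : NeZero N := ⟨by omega⟩
  have hL1 : 1 ≤ L := le_trans (by norm_num) hL
  have hM : 1 ≤ L ^ (k + 1) := Nat.one_le_pow _ _ (by omega)
  have htow : tower L N (k + 1) = L ^ (k + 1) * N := NE3CurvedProjectedLandau.tower_eq_pow_mul L N (k + 1)
  have hM2 : (0 : ℝ) < (((L ^ (k + 1) : ℕ) : ℝ)) ^ 2 := by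
    have h0 : (0 : ℝ) < ((L ^ (k + 1) : ℕ) : ℝ) := by exact_mod_cast (by omega : 0 < L ^ (k + 1))
    positivity
  -- the instantiation data (`U := cavgIter`, `ψ := bmeanIterW ζ′`)
  have hUu : IsUnitaryCfg (cavgIter L (k + 1) W) := (cavgIter_unitary_small (d := d) hL1 k hWu hx hs hWx).1
  have hUP : IsPeriodicCfg (cavgIter L (k + 1) W) (N : ℤ) := isPeriodicCfg_cavgIter L N (k + 1) hWP
  have hψP : ∀ (z : Site d) (τ : Fin d), bmeanIterW L (k + 1) W ζ' (z + (N : ℤ) • e τ) = bmeanIterW L (k + 1) W ζ' z :=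
    (bmeanIterW_skew_periodic (M := N) hL1 k hWu hWP hx hs hWx hζ's hζ'P).2
  have hWP' : IsPeriodicCfg W ((L ^ (k + 1) * N : ℕ) : ℤ) := by rw [← htow]; exact hWP
  have hη'M : ∀ (y : Site d) (τ μ : Fin d), η' (y + ((L ^ (k + 1) * N : ℕ) : ℤ) • e τ) μ = η' y μ := by
    intro y τ μ; rw [← htow]; exact hη'P y τ μ
  have horth' : ∑ y ∈ periodBox (d := d) (L ^ (k + 1) * N), hsR (ζ' y) (covDiv W η' y) = 0 := by rw [← htow]; exact horth
  -- K6b-0 at `η := η′`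
  have hcore := sum_nhsNormSq_le_core_sbound hM hN hWu hWP' hx hWx hη'M hUu hUP hψP
  -- the pairings (K6b-1, K6b-2a, the two faces, the coarse mismatch with `β = J4 = 8·loopRad(r_k)`)
  have hρ := abs_sum_hsR_rho_psiExt_le hL k N hWu hx hs hWx (covDiv W η') ζ' horth'
  have hcomb := abs_sum_hsR_combDefect_le hd hM N hWu hx hWx (bmeanIterW L (k + 1) W ζ') η'
  have hfar := abs_sum_hsR_farDefect_le (W := W) hd hM N hWu hx hWx η' (bmeanIterW L (k + 1) W ζ')
  have hnear := abs_sum_hsR_nearDefect_le (W := W) hd hM hN hWu hx hWx η' hη'M (bmeanIterW L (k + 1) W ζ')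
  have hβ : ∀ (z : Site d) (κ : Fin d), ‖((cavgIter L (k + 1) W z κ : (Matrix n n ℂ)ˣ) : Matrix n n ℂ)
      - ((bseg (L ^ (k + 1)) W z κ : (Matrix n n ℂ)ˣ) : Matrix n n ℂ)‖ ≤ 8 * loopRad d L ((prop1Radius d L)^[k] x) :=
    fun z κ => norm_cavgIter_sub_bseg_le_top hL k hWu hx hs hWx z κ
  have hmis := abs_sum_hsR_coarseMismatch_le (W := W) hd hM hN hWu hUu hβ η' hη'M (bmeanIterW L (k + 1) W ζ')
  have hloops := abs_sum_hsR_loops_le (periodBox (d := d) N) (bmeanIterW L (k + 1) W ζ') (combDefect W (L ^ (k + 1)) η')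
    (coarseMismatch (cavgIter L (k + 1) W) W (L ^ (k + 1)) η') (farDefect W (L ^ (k + 1)) η') (nearDefect W (L ^ (k + 1)) η')
  -- K6b-3: the non-exact weighted energy, respelled in the core bound's currency
  have hℰ := weightedEnergy_nonexact_le hL hN k hWu hWP hx hs hWx hS2 hY hη'P hζ'P hYeq
  rw [htow, pow_tower_d L d k] at hℰ
  have hfun : (fun (z : Site d) (μ : Fin d) => ((((L ^ (k + 1) : ℕ) : ℝ)) ^ d)⁻¹ • TWg (L ^ (k + 1)) (combFrame W (L ^ (k + 1))) η' z μ
        - cD (cavgIter L (k + 1) W) μ (bmeanIterW L (k + 1) W ζ') z)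
      = (fun (z : Site d) (μ : Fin d) => (((L : ℝ) ^ d)⁻¹) ^ (k + 1) • TWc L (k + 1) W η' z μ
        - cD (cavgIter L (k + 1) W) μ (bmeanIterW L (k + 1) W ζ') z) := by
    funext z μ
    rw [inv_pow_tower L d k]
    rfl
  rw [hfun] at hcore
  have hE := abs_RE_le hd hM N hWu (fun (z : Site d) (μ : Fin d) => (((L : ℝ) ^ d)⁻¹) ^ (k + 1) • TWc L (k + 1) W η' z μ
        - cD (cavgIter L (k + 1) W) μ (bmeanIterW L (k + 1) W ζ') z) η'
  refine core_assemble hM2 hcore (hE.trans (mul_le_mul_of_nonneg_right (Real.sqrt_le_sqrt hℰ) (Real.sqrt_nonneg _))) hρ ?_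
  linarith [hloops, hcomb, hmis, hfar, hnear]

end

end Summit.QuantumFields.BalabanUV.T4Continuum.NE3SlicePoincareEtaBound
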